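import Literature.NumberTheory.Automorphic.HarishChandraFinitenessGLCuspidal
import Literature.NumberTheory.Automorphic.ArchimedeanCharacterTwist
import Literature.NumberTheory.Automorphic.AutomorphicTwistNorm
import Literature.NumberTheory.Automorphic.AutomorphicRepDataSplitCenter
import Literature.NumberTheory.Automorphic.CuspFormSliceReduction
import Literature.NumberTheory.Automorphic.AutomorphicFormsGrowthFolland
import HarnessLib

/-!
# Harish-Chandra's finiteness theorem for cusp forms on `GL_n(𝔸_K)` with a `Z(𝔤)`-character,
# without `A_G`-invariance: twisting by `|det|_𝔸^s` and the Casimir eigenvalue of a twist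
# (Borel–Jacquet 1979, 4.3 (i), 4.4, 5.7)

Topic `NumberTheory/Automorphic`; sequel to `HarishChandraFinitenessGLCuspidal`, which proves the
cuspidal case of Harish-Chandra's finiteness theorem (Borel–Jacquet, Corvallis 1979, 4.3 (i);
Harish-Chandra, LNM 62 (1968), Thm. 1) for cusp forms on `GL_n(𝔸_K)` INVARIANT UNDER THE SPLIT
COMPONENT `A_G` (the `L²` theory of the tree lives on `GL_n(K) A_G \ GL_n(𝔸_K)`). Here the invariance
under `A_G` is removed for cusp forms with a `Z(𝔤)`-character `θ` — the form in which the cusp forms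
enter the named fact `harishChandra_finiteness_gl hcpt` of `AutomorphicRepsGL` — by the classical
normalisation `φ ↦ |det|_𝔸^s · φ` (Borel–Jacquet 1979, 5.7: "`π = π₀ ⊗ |det|^s`"; Arthur–Clozel 1989,
Ch. 3: "We may assume `π` unitary"), WITHOUT transporting `θ` through the twist: the compact-operator
proof of the finiteness theorem only consumes the Casimir operator and `𝔨`, and the Casimir operator
of a twist of a `θ`-eigenfunction is computed outright.

* §A `lieDeriv_lieDeriv_mulChar_of_exp` (second-order Leibniz rule for `c · φ`, `c` a character with
  differential `δ` along `exp 𝔤`), `applyFree_casimirWord_eq_sum` (the Casimir word acts as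
  `∑_p ε_p X_p X_{p̄}`).
* §B linear forms `λ` on `𝔤𝔩(N, A)` killing brackets: `λ(x E_{ab}) = 0` for `a ≠ b`,
  `λ(x E_{aa}) = λ(x E_{bb})`; the diagonal generators `x · 1 = ∑_a x E_{aa}` are central.
* §C `exists_applyFree_casimirWord_mulChar_eq_smul` — **the Casimir operator of the twist `c · φ` of a
  smooth `φ` with `Z(𝔤)`-character `θ` is a scalar `w(θ, δ)`**:
  `Ω (c φ) = c (Ω φ + 2 ∑_p ε_p δ(X_{p̄}) X_p φ + κ φ)` and the cross term is
  `∑_s ε_s δ(u_s E_{a₀a₀}) (u_s · 1) φ` with `u_s · 1` central, acting through `θ`.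
* §D `finiteDimensional_span_cuspForms_of_casimir_eq_smul` — `A_G`-invariant cusp forms of level `U`
  with ONE Casimir eigenvalue `w` and `K_∞`-slices in a finite-dimensional `K_∞`-stable `M` span a
  finite-dimensional space (the proof of `finiteDimensional_span_cuspForms_of_ideal` with the
  polynomial `X - w`; `Ω` commutes with `𝔨`, so the spanning set is `𝔨`-stable).
* §E `apply_posRealScalar_mul_eq_cpow_of_hasZCharacter` (`φ(a g) = a^{θ(ι 1)} φ(g)` on `A_G`) and
  `finiteDimensional_span_cuspForms_of_hasZCharacter` — **for `n ≥ 1`, a level `U`, a character `θ` of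
  `Z(𝔤)` and a finite-dimensional right-`K_∞`-stable `M`, the cusp forms on `GL_n(𝔸_K)` of level `U`
  with `Z(𝔤)`-character `θ` and `K_∞`-slices in `M` span a finite-dimensional space**: the twist by
  `|det|_𝔸^{s}`, `s = -θ(ι 1)/(n[K:ℚ])`, is linear, injective, and lands in the space of §D
  (`IsCuspFormGL.mulChar_detTwist_of_cpow`, `mulChar_detTwist_apply_posRealScalar_mul_of_cpow`,
  `|det|_𝔸 = 1` on levels and on `K_∞`); `finiteDimensional_span_cuspForms_of_hasZCharacter'` records
  all `n` (`GL_0` is trivial).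

Everything here is proved; there are no definitions and no named facts.

## References

* A. Borel, H. Jacquet, *Automorphic forms and automorphic representations*, Proc. Sympos. Pure
  Math. 33.1 (Corvallis 1979), 189–202, 4.3 (i)–(ii), 4.4, 5.7 [BorelJacquet1979].
* Harish-Chandra, *Automorphic forms on semisimple Lie groups*, LNM 62 (1968), §2, Thm. 1.
* A. W. Knapp, *Lie Groups Beyond an Introduction*, 2nd ed. (2002), §V.4 (Casimir element).
* J. Arthur, L. Clozel, *Simple algebras, base change, and the advanced theory of the trace
  formula*, Ann. of Math. Stud. 120 (1989), Ch. 3, proof of Thm. 3.1 [ArthurClozelAMS120].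
-/

noncomputable section

open scoped MatrixGroups Matrix ContDiff Topology Classical NNReal
open Filter Polynomial Set
open NumberField NumberField.mixedEmbedding IsDedekindDomain
open _root_.MeasureTheory _root_.MeasureTheory.Measure

namespace Literature.NumberTheory.Automorphic

/-! ### A. The second-order Leibniz rule and the action of the Casimir word -/

section Leibniz

variable {A : Type*} [NormedCommRing A] [NormedAlgebra ℝ A] [NormedAlgebra ℚ A] [CompleteSpace A]
  [StarRing A] {N : Type*} [Fintype N] [DecidableEq N] {H : RealMatrixGroup A N}
  {G : Type*} [Group G] (ι : H.carrier →* G) {c : G →* ℂˣ} {δ : H.lie →ₗ[ℝ] ℂ}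

/-- **Second-order Leibniz rule for `c · φ`**: for `φ` smooth in the archimedean variable and a
character `c` with differential `δ` along `exp 𝔤` (`c (ι (exp X)) = e^{δ(X)}`),
`X (Y (c · φ)) = c · (X (Y φ) + δ(Y) X φ + δ(X) Y φ + δ(X) δ(Y) φ)` (`lieDeriv_mulChar_of_exp` twice;
`H.lie = ⊤` so that `Y φ` is smooth). Borel–Jacquet 1979, §1.5 and 5.7. [cite: BorelJacquet1979, §1.5] -/
theorem lieDeriv_lieDeriv_mulChar_of_exp [FiniteDimensional ℝ A] (hH : H.lie = ⊤)
    (hc : ∀ X : H.lie, (c (ι (H.expMem X)) : ℂ) = Complex.exp (δ X)) (X Y : H.lie) {φ : G → ℂ}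
    (hφ : IsArchSmooth ι φ) :
    lieDeriv ι X (lieDeriv ι Y (mulChar c φ)) =
      mulChar c (lieDeriv ι X (lieDeriv ι Y φ) + δ Y • lieDeriv ι X φ + δ X • lieDeriv ι Y φ +
        (δ X * δ Y) • φ) := by
  have hYφ : IsArchSmooth ι (lieDeriv ι Y φ) := isArchSmooth_lieDeriv_of_lie_eq_top ι hH Y hφ
  have hφs : IsArchSmooth ι (δ Y • φ) := (archSmooth ι).smul_mem _ hφ
  have hsm : IsArchSmooth ι (lieDeriv ι Y φ + δ Y • φ) := (archSmooth ι).add_mem hYφ hφs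
  rw [lieDeriv_mulChar_of_exp ι hc Y hφ, lieDeriv_mulChar_of_exp ι hc X hsm,
    IsArchSmooth.lieDeriv_add ι X hYφ hφs, lieDeriv_smul]
  congr 1
  simp only [smul_add, smul_smul, mul_comm (δ X) (δ Y)]
  abel

end Leibniz

section CasimirWord

variable {A : Type*} [NormedCommRing A] [NormedAlgebra ℝ A] [NormedAlgebra ℚ A] [CompleteSpace A]
  [StarRing A] {N : Type*} [Fintype N] [DecidableEq N] {S : Type*} [Fintype S]
  {G : Type*} [Group G] (ι : (RealMatrixGroup.gl A N).carrier →* G)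

/-- **The Casimir word acts as `∑_p ε_p X_p (X_{p̄} ·)`** (`X_p = u_s E_{ab}`, `p̄ = (s, b, a)`; no
smoothness needed: the word action is `ℝ`-linear in the word and `(ι X · ι Y) ψ = X (Y ψ)`).
Knapp 2002, §V.4; Harish-Chandra 1953, §11. [folklore] -/
theorem applyFree_casimirWord_eq_sum (F : SelfDualUnits A S) (ψ : G → ℂ) :
    applyFree ι (casimirWord (N := N) F) ψ =
      ∑ p : S × N × N, (F.ε p.1 : ℂ) •
        lieDeriv ι (unitGen F p) (lieDeriv ι (unitGen F (p.1, p.2.2, p.2.1)) ψ) := by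
  -- the word action at `ψ`, an `ℝ`-linear map in the word
  let L : FreeAlgebra ℝ (RealMatrixGroup.gl A N).lie →ₗ[ℝ] (G → ℂ) :=
    { toFun := fun q => applyFree ι q ψ
      map_add' := fun q₁ q₂ => applyFree_add ι q₁ q₂ ψ
      map_smul' := fun a q => by rw [applyFree_smul_left, RingHom.id_apply, real_smul_fun_eq_coe_smul] }
  have hL : ∀ q, applyFree ι q ψ = L q := fun q => rfl
  rw [casimirWord, hL, _root_.map_sum]
  refine Finset.sum_congr rfl fun p _ => ?_
  rw [map_smul, ← hL, applyFree_mul_ι, applyFree_ι_eq_lieDeriv, real_smul_fun_eq_coe_smul]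

end CasimirWord

/-! ### B. Linear forms on `𝔤𝔩(N, A)` killing brackets -/

section BracketForms

variable {A : Type*} [NormedCommRing A] [NormedAlgebra ℝ A] [NormedAlgebra ℚ A] [CompleteSpace A]
  [StarRing A] {N : Type*} [Fintype N] [DecidableEq N]
  {V : Type*} [AddCommGroup V] [Module ℝ V]

-- Mathlib idiom (Mathlib/Algebra/Lie/OfAssociative.lean): the commutator bracket on matrices is needed
-- to state `lam ⁅X, Y⁆ = 0` for `X Y : 𝔤𝔩(N, A)`; it is the instance the tree uses throughout.

/-- A linear form killing brackets vanishes off the diagonal: `λ(x E_{ab}) = 0` for `a ≠ b`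
(`x E_{ab} = [E_{aa}, x E_{ab}]`). [folklore] -/
theorem apply_glGenL_eq_zero_of_ne (lam : (RealMatrixGroup.gl A N).lie →ₗ[ℝ] V)
    (hlam : ∀ X Y : (RealMatrixGroup.gl A N).lie, lam ⁅X, Y⁆ = 0) {a b : N} (hab : a ≠ b) (x : A) :
    lam (glGenL A a b x) = 0 := by
  have h := hlam (glGenL A a a 1) (glGenL A a b x)
  rw [bracket_glGenL, if_pos rfl, if_neg (Ne.symm hab), sub_zero, one_mul] at h
  exact h

/-- A linear form killing brackets is constant along the diagonal: `λ(x E_{aa}) = λ(x E_{bb})`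
(`x E_{aa} - x E_{bb} = [E_{ab}, x E_{ba}]`). [folklore] -/
theorem apply_glGenL_diag_eq (lam : (RealMatrixGroup.gl A N).lie →ₗ[ℝ] V)
    (hlam : ∀ X Y : (RealMatrixGroup.gl A N).lie, lam ⁅X, Y⁆ = 0) (a b : N) (x : A) :
    lam (glGenL A a a x) = lam (glGenL A b b x) := by
  by_cases hab : a = b
  · rw [hab]
  · have h := hlam (glGenL A a b 1) (glGenL A b a x)
    rw [bracket_glGenL, if_pos rfl, if_pos rfl, one_mul, mul_one, map_sub, sub_eq_zero] at h
    exact h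

variable (A) in
/-- The scalar generator `x ↦ x · 1` of `𝔤𝔩(N, A)`. [folklore] -/
theorem coe_sum_glGenL_diag (x : A) :
    ((∑ a : N, glGenL A a a x : (RealMatrixGroup.gl A N).lie) : Matrix N N A) = Matrix.diagonal fun _ => x := by
  rw [AddSubmonoidClass.coe_finsetSum]
  ext i j
  simp only [coe_glGenL, Matrix.sum_apply, Matrix.single_apply, Matrix.diagonal_apply]
  by_cases hij : i = j
  · subst hij
    simp
  · rw [if_neg hij]
    refine Finset.sum_eq_zero fun a _ => ?_
    rw [if_neg]
    rintro ⟨rfl, rfl⟩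
    exact hij rfl

/-- **The diagonal generator `x · 1 = ∑_a x E_{aa}` is central in `𝔤𝔩(N, A)`** (`A` commutative).
[folklore] -/
theorem lie_sum_glGenL_diag (x : A) (Y : (RealMatrixGroup.gl A N).lie) :
    ⁅(∑ a : N, glGenL A a a x : (RealMatrixGroup.gl A N).lie), Y⁆ = 0 := by
  -- Mathlib idiom (Mathlib/Algebra/Lie/OfAssociative.lean): the commutator Lie ring on matrices
  letI : LieRing (Matrix N N A) := LieRing.ofAssociativeRing
  apply Subtype.ext
  rw [LieSubalgebra.coe_bracket, Ring.lie_def, coe_sum_glGenL_diag, ZeroMemClass.coe_zero]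
  ext i j
  simp only [Matrix.sub_apply, Matrix.diagonal_mul, Matrix.mul_diagonal, Matrix.zero_apply, mul_comm x, sub_self]

end BracketForms


/-! ### C. The Casimir operator on the twist of a function with a `Z(𝔤)`-character -/

section CasimirTwist

variable {A : Type*} [NormedCommRing A] [NormedAlgebra ℝ A] [NormedAlgebra ℚ A] [CompleteSpace A]
  [StarRing A] [FiniteDimensional ℝ A] {N : Type*} [Fintype N] [DecidableEq N] {S : Type*} [Fintype S]
  {G : Type*} [Group G] (ι : (RealMatrixGroup.gl A N).carrier →* G)

omit [FiniteDimensional ℝ A] in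
/-- The diagonal generators `x · 1 = ∑_a x E_{aa}` give central words `ι(x · 1)` of `U(𝔤)`.
[folklore] -/
theorem isCentralWord_ι_sum_glGenL_diag (x : A) :
    IsCentralWord (H := RealMatrixGroup.gl A N) (FreeAlgebra.ι ℝ (∑ a : N, glGenL A a a x)) := by
  rw [IsCentralWord, freeToEnveloping_ι]
  exact ι_mem_centerU_of_forall_lie_eq_zero (lie_sum_glGenL_diag x)

/-- The Lie derivative along a finite sum of directions (smooth functions). [folklore] -/
theorem lieDeriv_sum_left {κ : Type*} (s : Finset κ) (Y : κ → (RealMatrixGroup.gl A N).lie)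
    {φ : G → ℂ} (hφ : IsArchSmooth ι φ) :
    lieDeriv ι (∑ k ∈ s, Y k) φ = ∑ k ∈ s, lieDeriv ι (Y k) φ := by
  have h := lieDeriv_finset_sum_smul_left ι s (fun _ => (1 : ℝ)) Y hφ
  simpa only [one_smul, Complex.ofReal_one] using h

/-- **The diagonal cross term.** For a linear form `δ` on `𝔤𝔩(N, A)` killing brackets and a smooth
`φ`: `∑_{a,b} δ(u E_{ba}) · (u E_{ab}) φ = δ(u E_{a₀a₀}) · (u · 1) φ` — only the diagonal survives
(`apply_glGenL_eq_zero_of_ne`), `δ(u E_{aa})` does not depend on `a` (`apply_glGenL_diag_eq`), and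
`∑_a (u E_{aa}) φ = (u · 1) φ`. [folklore] -/
theorem sum_sum_delta_smul_lieDeriv_eq {δ : (RealMatrixGroup.gl A N).lie →ₗ[ℝ] ℂ}
    (hδ : ∀ X Y : (RealMatrixGroup.gl A N).lie, δ ⁅X, Y⁆ = 0) (a₀ : N) (u : A) {φ : G → ℂ}
    (hφ : IsArchSmooth ι φ) :
    ∑ a : N, ∑ b : N, δ (glGenL A b a u) • lieDeriv ι (glGenL A a b u) φ =
      δ (glGenL A a₀ a₀ u) • lieDeriv ι (∑ a : N, glGenL A a a u) φ := by
  have hinner : ∀ a : N, ∑ b : N, δ (glGenL A b a u) • lieDeriv ι (glGenL A a b u) φ =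
      δ (glGenL A a₀ a₀ u) • lieDeriv ι (glGenL A a a u) φ := by
    intro a
    rw [Finset.sum_eq_single a, apply_glGenL_diag_eq δ hδ a a₀ u]
    · intro b _ hba
      rw [apply_glGenL_eq_zero_of_ne δ hδ hba u, zero_smul]
    · intro h
      exact absurd (Finset.mem_univ a) h
  simp_rw [hinner]
  rw [← Finset.smul_sum, lieDeriv_sum_left ι Finset.univ _ hφ]

/-- **The Casimir operator on the twist `c · φ` of a function with `Z(𝔤)`-character `θ` is a
scalar depending only on `(θ, δ)`.** For `c` a character of `G` with differential `δ` along `exp 𝔤`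
killing brackets (e.g. `|det|_𝔸^s` on `GL_n(𝔸_K)`, `δ = s λ`) there is `w ∈ ℂ` such that
`Ω (c · φ) = w · (c · φ)` for every smooth `φ` on which `Z(𝔤)` acts through `θ`:
by the second-order Leibniz rule `Ω(c φ) = c · (Ω φ + 2 ∑_p ε_p δ(X_{p̄}) X_p φ + κ φ)` with
`κ = ∑_p ε_p δ(X_p) δ(X_{p̄})`, `Ω φ = θ(Ω) φ`, and the cross term is `∑_s ε_s δ(u_s E_{a₀a₀}) (u_s · 1) φ`
(`sum_sum_delta_smul_lieDeriv_eq`) with `u_s · 1` central in `𝔤`, acting by `θ`. This is the effect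
of the twist `π ↦ π ⊗ |det|^s` on the Casimir eigenvalue (Borel–Jacquet 1979, 5.7; Knapp 2002,
§V.4–V.5). [cite: BorelJacquet1979, 5.7] -/
theorem exists_applyFree_casimirWord_mulChar_eq_smul [Nonempty N] (F : SelfDualUnits A S)
    {c : G →* ℂˣ} {δ : (RealMatrixGroup.gl A N).lie →ₗ[ℝ] ℂ}
    (hc : ∀ X : (RealMatrixGroup.gl A N).lie, (c (ι ((RealMatrixGroup.gl A N).expMem X)) : ℂ) = Complex.exp (δ X))
    (hδ : ∀ X Y : (RealMatrixGroup.gl A N).lie, δ ⁅X, Y⁆ = 0)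
    (θ : centerU (RealMatrixGroup.gl A N) →ₐ[ℝ] ℂ) :
    ∃ w : ℂ, ∀ φ : G → ℂ, IsArchSmooth ι φ → HasZCharacter ι φ θ →
      applyFree ι (casimirWord (N := N) F) (mulChar c φ) = w • mulChar c φ := by
  obtain ⟨a₀⟩ := ‹Nonempty N›
  have hcw : IsCentralWord (H := RealMatrixGroup.gl A N) (casimirWord (N := N) F) := isCentralWord_casimirWord F
  -- the constants
  set zd : S → centerU (RealMatrixGroup.gl A N) := fun s =>
    ⟨freeToEnveloping (RealMatrixGroup.gl A N) (FreeAlgebra.ι ℝ (∑ a : N, glGenL A a a (F.u s))),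
      isCentralWord_ι_sum_glGenL_diag (N := N) (F.u s)⟩ with hzd
  set τ : ℂ := ∑ s, (F.ε s : ℂ) * (δ (glGenL A a₀ a₀ (F.u s)) * θ (zd s)) with hτ
  set κ : ℂ := ∑ p : S × N × N, (F.ε p.1 : ℂ) * (δ (unitGen F p) * δ (unitGen F (p.1, p.2.2, p.2.1))) with hκ
  refine ⟨θ ⟨freeToEnveloping (RealMatrixGroup.gl A N) (casimirWord (N := N) F), hcw⟩ + (τ + τ) + κ,
    fun φ hφ hθ => ?_⟩
  have hH : (RealMatrixGroup.gl A N).lie = ⊤ := rfl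
  -- the diagonal generators act by `θ`
  have hdiag : ∀ s, lieDeriv ι (∑ a : N, glGenL A a a (F.u s)) φ = θ (zd s) • φ := fun s => by
    rw [← applyFree_ι_eq_lieDeriv, hθ _ (isCentralWord_ι_sum_glGenL_diag (N := N) (F.u s))]
  -- the four sums of the second-order Leibniz rule
  have t1 : ∑ p : S × N × N, (F.ε p.1 : ℂ) •
      lieDeriv ι (unitGen F p) (lieDeriv ι (unitGen F (p.1, p.2.2, p.2.1)) φ) =
      θ ⟨freeToEnveloping (RealMatrixGroup.gl A N) (casimirWord (N := N) F), hcw⟩ • φ := by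
    rw [← applyFree_casimirWord_eq_sum, hθ _ hcw]
  have t2 : ∑ p : S × N × N, (F.ε p.1 : ℂ) •
      (δ (unitGen F (p.1, p.2.2, p.2.1)) • lieDeriv ι (unitGen F p) φ) = τ • φ := by
    rw [Fintype.sum_prod_type, hτ, Finset.sum_smul]
    refine Finset.sum_congr rfl fun s _ => ?_
    rw [Fintype.sum_prod_type]
    have e : ∑ a : N, ∑ b : N, (F.ε s : ℂ) • (δ (unitGen F (s, b, a)) • lieDeriv ι (unitGen F (s, a, b)) φ) =
        (F.ε s : ℂ) • (δ (glGenL A a₀ a₀ (F.u s)) • lieDeriv ι (∑ a : N, glGenL A a a (F.u s)) φ) := by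
      simp_rw [← Finset.smul_sum]
      exact congrArg _ (sum_sum_delta_smul_lieDeriv_eq ι hδ a₀ (F.u s) hφ)
    refine e.trans ?_
    rw [hdiag s, smul_smul, smul_smul, mul_assoc]
  have t3 : ∑ p : S × N × N, (F.ε p.1 : ℂ) •
      (δ (unitGen F p) • lieDeriv ι (unitGen F (p.1, p.2.2, p.2.1)) φ) = τ • φ := by
    rw [Fintype.sum_prod_type, hτ, Finset.sum_smul]
    refine Finset.sum_congr rfl fun s _ => ?_
    rw [Fintype.sum_prod_type]
    have e : ∑ a : N, ∑ b : N, (F.ε s : ℂ) • (δ (unitGen F (s, a, b)) • lieDeriv ι (unitGen F (s, b, a)) φ) =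
        (F.ε s : ℂ) • (δ (glGenL A a₀ a₀ (F.u s)) • lieDeriv ι (∑ a : N, glGenL A a a (F.u s)) φ) := by
      rw [Finset.sum_comm]
      simp_rw [← Finset.smul_sum]
      exact congrArg _ (sum_sum_delta_smul_lieDeriv_eq ι hδ a₀ (F.u s) hφ)
    refine e.trans ?_
    rw [hdiag s, smul_smul, smul_smul, mul_assoc]
  have t4 : ∑ p : S × N × N, (F.ε p.1 : ℂ) •
      ((δ (unitGen F p) * δ (unitGen F (p.1, p.2.2, p.2.1))) • φ) = κ • φ := by
    rw [hκ, Finset.sum_smul]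
    refine Finset.sum_congr rfl fun p _ => ?_
    rw [smul_smul]
  -- assemble
  have key : ∑ p : S × N × N, (F.ε p.1 : ℂ) •
      (lieDeriv ι (unitGen F p) (lieDeriv ι (unitGen F (p.1, p.2.2, p.2.1)) φ) +
        δ (unitGen F (p.1, p.2.2, p.2.1)) • lieDeriv ι (unitGen F p) φ +
        δ (unitGen F p) • lieDeriv ι (unitGen F (p.1, p.2.2, p.2.1)) φ +
        (δ (unitGen F p) * δ (unitGen F (p.1, p.2.2, p.2.1))) • φ) =
      (θ ⟨freeToEnveloping (RealMatrixGroup.gl A N) (casimirWord (N := N) F), hcw⟩ + (τ + τ) + κ) • φ := by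
    simp only [smul_add, Finset.sum_add_distrib, t1, t2, t3, t4, add_smul]
    abel
  calc applyFree ι (casimirWord (N := N) F) (mulChar c φ)
      = ∑ p : S × N × N, (F.ε p.1 : ℂ) • mulChar c
          (lieDeriv ι (unitGen F p) (lieDeriv ι (unitGen F (p.1, p.2.2, p.2.1)) φ) +
            δ (unitGen F (p.1, p.2.2, p.2.1)) • lieDeriv ι (unitGen F p) φ +
            δ (unitGen F p) • lieDeriv ι (unitGen F (p.1, p.2.2, p.2.1)) φ +
            (δ (unitGen F p) * δ (unitGen F (p.1, p.2.2, p.2.1))) • φ) := by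
        rw [applyFree_casimirWord_eq_sum]
        refine Finset.sum_congr rfl fun p _ => ?_
        rw [lieDeriv_lieDeriv_mulChar_of_exp ι hH hc _ _ hφ]
    _ = mulChar c (∑ p : S × N × N, (F.ε p.1 : ℂ) •
          (lieDeriv ι (unitGen F p) (lieDeriv ι (unitGen F (p.1, p.2.2, p.2.1)) φ) +
            δ (unitGen F (p.1, p.2.2, p.2.1)) • lieDeriv ι (unitGen F p) φ +
            δ (unitGen F p) • lieDeriv ι (unitGen F (p.1, p.2.2, p.2.1)) φ +
            (δ (unitGen F p) * δ (unitGen F (p.1, p.2.2, p.2.1))) • φ)) := by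
        rw [_root_.map_sum]
        refine Finset.sum_congr rfl fun p _ => ?_
        rw [map_smul]
    _ = _ := by rw [key, map_smul]

end CasimirTwist


/-! ### D. `A_G`-invariant cusp forms with a Casimir eigenvalue span a finite-dimensional space -/

section Eigen

variable {n : ℕ} {K : Type} [Field K] [NumberField K] {hcpt : isCompact_glFiniteIntegralLevel n K}

-- the scoped operator norm on `𝔤𝔩_n(K_∞)`, through which `IsArchSmooth` is defined
open scoped Matrix.Norms.Operator

set_option maxHeartbeats 1600000 in
/-- **`A_G`-invariant cusp forms on `GL_n(𝔸_K)` of level `U` with a fixed Casimir eigenvalue and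
`K_∞`-slices in a finite-dimensional `K_∞`-stable space span a finite-dimensional space.** Here the
Casimir operator is that of the self-dual units of `K_∞` (`casimirWord (SelfDualUnits.mixedSpace K)`,
`Ω φ = w φ` with `w ∈ ℂ` fixed), and no `Z(𝔤)`-finiteness beyond the eigenvalue equation is used: this
is exactly what the compact-operator proof of Harish-Chandra's finiteness theorem for cusp forms
consumes (`IsL2LieStable.finiteDimensional_of_aeval_eq_zero` with the polynomial `X - w`; the
`𝔨`-generators are uniformly algebraic by `exists_polynomial_kGen_of_slices`, the spanning set being
`𝔨`-stable because `Ω` commutes with `𝔨`). Harish-Chandra 1968, §2, Lemma 9; Borel 1997, Thm. 8.5;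
Borel–Jacquet 1979, 4.3 (i)–(ii), 4.4. [cite: BorelJacquet1979, 4.3 (i)] -/
theorem finiteDimensional_span_cuspForms_of_casimir_eq_smul {U : Subgroup (GL (Fin n) (AdeleRing (𝓞 K) K))}
    (hU : U ∈ finiteLevelsGL n K) (w : ℂ)
    (M : Submodule ℂ (Kinf n K → ℂ)) [FiniteDimensional ℂ M]
    (hM : ∀ k₀ : Kinf n K, ∀ f ∈ M, (fun k => f (k * k₀)) ∈ M) :
    FiniteDimensional ℂ (Submodule.span ℂ
      {φ : (AdelicGroupData.gl n K).Adelic → ℂ |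
        IsCuspFormGL n K hcpt φ ∧
        (∀ z ∈ (AdelicGroupData.gl n K).center', ∀ g, φ (z * g) = φ g) ∧
        IsRightInvariantUnder U φ ∧
        applyFree (AutomorphyDatum.gl n K hcpt).ofArch (casimirWord (N := Fin n) (SelfDualUnits.mixedSpace K)) φ = w • φ ∧
        ∀ g : (AdelicGroupData.gl n K).Adelic,
          (fun k : Kinf n K => φ (g * (AutomorphyDatum.gl n K hcpt).ofK k)) ∈ M}) := by
  have hH : (AutomorphyDatum.gl n K hcpt).arch.lie = ⊤ := archGroupGL_lie n K
  have hc : (AutomorphyDatum.gl n K hcpt).arch.carrier = ⊤ := archGroupGL_carrier n K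
  -- the level `U = {1} × U₀`
  obtain ⟨U₀, hU₀o, hU₀c, rfl⟩ := mem_finiteLevelsGL_iff.1 hU
  -- an automorphic measure on `GL_n(𝔸_K) ⧸ A_G GL_n(K)`
  obtain ⟨μ, hμ⟩ := (AdelicGroupData.exists_isAutomorphicMeasure_gl_holds (n := n) (K := K) :
    AdelicGroupData.exists_isAutomorphicMeasure_gl n K)
  haveI := hμ
  set F := SelfDualUnits.mixedSpace K with hF_def
  -- the Casimir word, as an element of the free algebra of the datum
  set cw : FreeAlgebra ℝ (AutomorphyDatum.gl n K hcpt).arch.lie := casimirWord (N := Fin n) F with hcw_def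
  have hcwc : IsCentralWord (H := (AutomorphyDatum.gl n K hcpt).arch) cw := isCentralWord_casimirWord F
  have e3 : freeToEnveloping (AutomorphyDatum.gl n K hcpt).arch cw = casimirU F := freeToEnveloping_casimirWord F
  -- the generating set
  set S : Set ((AdelicGroupData.gl n K).Adelic → ℂ) :=
    {φ : (AdelicGroupData.gl n K).Adelic → ℂ |
      IsCuspFormGL n K hcpt φ ∧
      (∀ z ∈ (AdelicGroupData.gl n K).center', ∀ g, φ (z * g) = φ g) ∧
      IsRightInvariantUnder (U₀.map (GLn.ofFinite n K)) φ ∧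
      applyFree (AutomorphyDatum.gl n K hcpt).ofArch cw φ = w • φ ∧
      ∀ g : (AdelicGroupData.gl n K).Adelic, (fun k : Kinf n K => φ (g * (AutomorphyDatum.gl n K hcpt).ofK k)) ∈ M}
    with hS_def
  change FiniteDimensional ℂ (Submodule.span ℂ S)
  -- the ambient `L²`-Lie-stable space of `A_G`-invariant cusp forms
  set W : Submodule ℂ ((AdelicGroupData.gl n K).Adelic → ℂ) :=
    cuspFormsGL n K hcpt ⊓ (AdelicGroupData.gl n K).bddInvariant with hW_def
  have h : IsL2LieStable (AutomorphyDatum.gl n K hcpt) μ W := isL2LieStable_cuspFormsGL_inf_bddInvariant μ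
  have hSW : S ⊆ W := fun φ hφ =>
    mem_cuspFormsGL_inf_bddInvariant_iff.2 ⟨hφ.1.mem_cuspFormsGL, hφ.2.1⟩
  have hspanW : Submodule.span ℂ S ≤ W := Submodule.span_le.2 hSW
  set V₀ : Submodule ℂ W := (Submodule.span ℂ S).comap W.subtype with hV₀_def
  have hV₀ : ∀ φ : W, φ ∈ V₀ → (φ : (AdelicGroupData.gl n K).Adelic → ℂ) ∈ Submodule.span ℂ S :=
    fun φ hφ => hφ
  have hSsm : ∀ φ ∈ S, IsArchSmooth (AutomorphyDatum.gl n K hcpt).ofArch φ := fun φ hφ => hφ.1.1.archSmooth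
  -- (i) the elements of `V₀` have level `{1} × U₀`
  have hUlev : U₀.map (GLn.ofFinite n K) ∈ finiteLevelsGL n K := ⟨U₀, hU₀o, hU₀c, rfl⟩
  have hlev : ∀ φ ∈ V₀, IsRightInvariantUnder (U₀.map (GLn.ofFiniteAdelic n K))
      ((φ : W) : (AdelicGroupData.gl n K).Adelic → ℂ) := by
    intro φ hφ
    have key : ∀ ψ ∈ Submodule.span ℂ S, IsRightInvariantUnder (U₀.map (GLn.ofFinite n K)) ψ := by
      intro ψ hψ
      induction hψ using Submodule.span_induction with
      | mem ψ h => exact h.2.2.1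
      | zero => exact fun _ _ _ => rfl
      | add _ _ _ _ h₁ h₂ => exact fun u hu g => by simp only [Pi.add_apply, h₁ u hu g, h₂ u hu g]
      | smul c _ _ h => exact fun u hu g => by simp only [Pi.smul_apply, h u hu g]
    exact key _ (hV₀ φ hφ)
  -- (ii) their classes lie in `L²_cusp`
  have hcusp : ∀ φ ∈ V₀, h.cl φ ∈ cuspidalSubspace n K μ := fun φ _ =>
    cl_mem_cuspidalSubspace_cuspFormsGL_inf_bddInvariant μ φ
  -- (iii) the Casimir operator is killed by `X - w` on `V₀`
  set T : Module.End ℂ W := envelopingAction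
    (h.isLieStableSmooth.lieRep (archGroupGL_lie n K) (archGroupGL_carrier n K)) (casimirU F) with hT_def
  have hT : ∀ φ : W, ((T φ : W) : (AdelicGroupData.gl n K).Adelic → ℂ) =
      applyFree (AutomorphyDatum.gl n K hcpt).ofArch cw φ := by
    intro φ
    rw [hT_def, ← e3, h.isLieStableSmooth.coe_envelopingAction_lieRep_freeToEnveloping (archGroupGL_lie n K)
      (archGroupGL_carrier n K)]
  have hΩgen : ∀ (ψ : (AdelicGroupData.gl n K).Adelic → ℂ) (hψ : ψ ∈ S),
      aeval T (X - C w) ⟨ψ, hSW hψ⟩ = 0 := by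
    intro ψ hψ
    apply Subtype.ext
    rw [map_sub, aeval_X, aeval_C, LinearMap.sub_apply, Module.algebraMap_end_apply, Submodule.coe_sub,
      Submodule.coe_smul, hT, Submodule.coe_zero]
    exact sub_eq_zero.2 hψ.2.2.2.1
  have hΩ : ∀ φ ∈ V₀, aeval T (X - C w) φ = 0 := by
    intro φ hφ
    have hle : Submodule.span ℂ S ≤ (LinearMap.ker (aeval T (X - C w))).map W.subtype := by
      refine Submodule.span_le.2 fun ψ hψ => ?_
      exact ⟨⟨ψ, hSW hψ⟩, LinearMap.mem_ker.2 (hΩgen ψ hψ), rfl⟩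
    obtain ⟨φ', hφ', hφ'φ⟩ := hle (hV₀ φ hφ)
    have hφφ : φ' = φ := Subtype.ext hφ'φ
    rw [← hφφ]
    exact LinearMap.mem_ker.1 hφ'
  -- (iv) the `𝔨`-generators are uniformly algebraic on `V₀` (the set `S` is `𝔨`-stable)
  have hSY : ∀ p, ∀ φ ∈ S, lieDeriv (AutomorphyDatum.gl n K hcpt).ofArch (kGen F p) φ ∈ S := by
    intro p φ hφ
    obtain ⟨hφc, hA, hφU, hφw, hφM⟩ := hφ
    refine ⟨hφc.lieDeriv_of_center' hA _, lieDeriv_apply_center'_mul hA _, hφU.lieDeriv_gl hUlev _, ?_, fun g =>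
        slice_lieDeriv_mem_of_forall_slice_mem M hM hφc.1.archSmooth hφM (kGen F p)
          (kGen_mem_compactLie F p) g⟩
    -- `Ω (Y φ) = Y (Ω φ) = Y (w φ) = w (Y φ)`
    have e : applyFree (AutomorphyDatum.gl n K hcpt).ofArch cw
        (lieDeriv (AutomorphyDatum.gl n K hcpt).ofArch (kGen F p) φ) =
        lieDeriv (AutomorphyDatum.gl n K hcpt).ofArch (kGen F p) (applyFree (AutomorphyDatum.gl n K hcpt).ofArch cw φ) :=
      applyFree_lieDeriv_of_isCentralWord hH hc hcwc (kGen F p) hφc.1.archSmooth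
    rw [e, hφw, lieDeriv_smul]
  have hkex := fun p => exists_polynomial_kGen_of_slices (hcpt := hcpt) S hSsm (kGen F p)
    (kGen_mem_compactLie F p) (hSY p) M (fun φ hφ => hφ.2.2.2.2)
  choose Pk hPk0 hPk using hkex
  have hk : ∀ p, ∀ φ ∈ V₀,
      aeval (h.isLieStableSmooth.lieRep (archGroupGL_lie n K) (archGroupGL_carrier n K) (kGen F p))
        (Pk p) φ = 0 := by
    intro p φ hφ
    apply Subtype.ext
    rw [aeval_eq_sum_range, LinearMap.sum_apply, Submodule.coe_sum, Submodule.coe_zero]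
    have hterm : ∀ i : ℕ, ((((Pk p).coeff i •
        h.isLieStableSmooth.lieRep (archGroupGL_lie n K) (archGroupGL_carrier n K) (kGen F p) ^ i) φ : W) :
          (AdelicGroupData.gl n K).Adelic → ℂ) =
        (Pk p).coeff i • iterLieDeriv (AutomorphyDatum.gl n K hcpt).ofArch (List.replicate i (kGen F p)) φ := by
      intro i
      rw [LinearMap.smul_apply, Submodule.coe_smul,
        h.isLieStableSmooth.coe_lieRep_pow_apply (archGroupGL_lie n K) (archGroupGL_carrier n K)]
    rw [Finset.sum_congr rfl fun i _ => hterm i]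
    exact hPk p _ (hV₀ φ hφ)
  -- (v) `V₀` is finite-dimensional, and `V₀ ≅ span S`
  haveI : FiniteDimensional ℂ V₀ :=
    h.finiteDimensional_of_aeval_eq_zero F V₀ hU₀o hU₀c hlev hcusp (X_sub_C_ne_zero w) hΩ Pk hPk0 hk
  have e : V₀ ≃ₗ[ℂ] Submodule.span ℂ S := Submodule.comapSubtypeEquivOfLe hspanW
  exact Module.Finite.equiv e

end Eigen

/-! ### E. Cusp forms with a `Z(𝔤)`-character: removal of the `A_G`-invariance by a twist -/

section Character

variable {n : ℕ} {K : Type} [Field K] [NumberField K] {hcpt : isCompact_glFiniteIntegralLevel n K}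

open Literature.NumberTheory.GaloisRepresentations (HeckeCharacter ideleGroup)

-- the scoped operator norm on `𝔤𝔩_n(K_∞)`, through which `IsArchSmooth` is defined
open scoped Matrix.Norms.Operator

/-- The word `ι(1)` of the central element `1 ∈ 𝔤𝔩_n(K_∞)` is a central word. [folklore] -/
theorem isCentralWord_ι_one :
    IsCentralWord (H := (AutomorphyDatum.gl n K hcpt).arch)
      (FreeAlgebra.ι ℝ (⟨1, trivial⟩ : (AutomorphyDatum.gl n K hcpt).arch.lie)) := by
  rw [IsCentralWord, freeToEnveloping_ι]
  exact ι_mem_centerU_of_forall_lie_eq_zero lie_one_eq_zero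

/-- **A smooth function with `Z(𝔤)`-character `θ` transforms under `A_G` by `a ↦ a^{μ}`,
`μ = θ(ι 1)`**: `1 ∈ 𝔤` is central and acts by `μ`, and `a = exp (log a · 1)`
(`posRealScalar_eq_ofArch_expMem`, `apply_mul_expMem_eq_exp_mul_of_lieDeriv_eq_smul`).
Borel–Jacquet 1979, 5.7. [cite: BorelJacquet1979, 5.7] -/
theorem apply_posRealScalar_mul_eq_cpow_of_hasZCharacter {φ : (AdelicGroupData.gl n K).Adelic → ℂ}
    (hφ : IsArchSmooth (AutomorphyDatum.gl n K hcpt).ofArch φ)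
    {θ : centerU (AutomorphyDatum.gl n K hcpt).arch →ₐ[ℝ] ℂ}
    (hθ : HasZCharacter (AutomorphyDatum.gl n K hcpt).ofArch φ θ) (t : ℝ≥0ˣ) (g : (AdelicGroupData.gl n K).Adelic) :
    φ ((show (AdelicGroupData.gl n K).Adelic from posRealScalar n K t) * g) =
      (((t : ℝ≥0) : ℝ) : ℂ) ^ (θ ⟨_, isCentralWord_ι_one (hcpt := hcpt)⟩) * φ g := by
  have hμ : lieDeriv (AutomorphyDatum.gl n K hcpt).ofArch (⟨1, trivial⟩ : (AutomorphyDatum.gl n K hcpt).arch.lie) φ =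
      θ ⟨_, isCentralWord_ι_one (hcpt := hcpt)⟩ • φ := by
    rw [← applyFree_ι_eq_lieDeriv]
    exact hθ _ _
  have ht : (0 : ℝ) < ((t : ℝ≥0) : ℝ) := NNReal.coe_pos.2 (pos_iff_ne_zero.2 t.ne_zero)
  have hcomm : (show (AdelicGroupData.gl n K).Adelic from posRealScalar n K t) * g =
      g * (show (AdelicGroupData.gl n K).Adelic from posRealScalar n K t) :=
    (Subgroup.mem_center_iff.1 (posRealScalar_mem_center n K t) g).symm
  rw [hcomm, posRealScalar_eq_ofArch_expMem (hcpt := hcpt) t,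
    apply_mul_expMem_eq_exp_mul_of_lieDeriv_eq_smul _ hφ hμ g]
  congr 1
  rw [Complex.cpow_def_of_ne_zero (Complex.ofReal_ne_zero.2 ht.ne'), ← Complex.ofReal_log ht.le, mul_comm]

set_option maxHeartbeats 1600000 in
/-- **Harish-Chandra's finiteness theorem for cusp forms on `GL_n(𝔸_K)` with a `Z(𝔤)`-character**
(`n ≥ 1`; the cuspidal case of the named fact `harishChandra_finiteness_gl hcpt` of `AutomorphicRepsGL`,
with NO invariance under `A_G` assumed; Borel–Jacquet 1979, 4.3 (i), 4.4 and 5.7). For a level `U`,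
a character `θ : Z(𝔤) →ₐ[ℝ] ℂ` and a finite-dimensional right-`K_∞`-stable space `M` of functions on
`K_∞`, the cusp forms of level `U` with `Z(𝔤)`-character `θ` and `K_∞`-slices in `M` span a
finite-dimensional space. Proof: such a `φ` satisfies `φ(a g) = a^{μ} φ(g)` on `A_G` with `μ = θ(ι 1)`
(`apply_posRealScalar_mul_eq_cpow_of_hasZCharacter`); the twist `φ ↦ |det|_𝔸^{s} · φ`,
`s = -μ / (n [K:ℚ])`, is linear and injective and maps `φ` to an `A_G`-invariant cusp form
(`IsCuspFormGL.mulChar_detTwist_of_cpow`, `mulChar_detTwist_apply_posRealScalar_mul_of_cpow`) of the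
same level (`|det u|_𝔸 = 1` on levels) with the same slices up to the factor `|det g|^s`
(`|det k|_𝔸 = 1` on `K_∞`) and with ONE Casimir eigenvalue `w = w(θ, s)`
(`exists_applyFree_casimirWord_mulChar_eq_smul`); the target space is finite-dimensional by
`finiteDimensional_span_cuspForms_of_casimir_eq_smul`. [cite: BorelJacquet1979, 4.3 (i)] -/
theorem finiteDimensional_span_cuspForms_of_hasZCharacter [NeZero n]
    {U : Subgroup (GL (Fin n) (AdeleRing (𝓞 K) K))} (hU : U ∈ finiteLevelsGL n K)
    (θ : centerU (archGroupGL n K) →ₐ[ℝ] ℂ)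
    (M : Submodule ℂ (Kinf n K → ℂ)) [FiniteDimensional ℂ M]
    (hM : ∀ k₀ : Kinf n K, ∀ f ∈ M, (fun k => f (k * k₀)) ∈ M) :
    FiniteDimensional ℂ (Submodule.span ℂ
      {φ : (AdelicGroupData.gl n K).Adelic → ℂ |
        IsCuspFormGL n K hcpt φ ∧ IsRightInvariantUnder U φ ∧
        HasZCharacter (AutomorphyDatum.gl n K hcpt).ofArch φ θ ∧
        ∀ g : (AdelicGroupData.gl n K).Adelic,
          (fun k : Kinf n K => φ (g * (AutomorphyDatum.gl n K hcpt).ofK k)) ∈ M}) := by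
  -- the exponent `μ` on `A_G` and the normalising `s`
  set μ₀ : ℂ := θ ⟨_, isCentralWord_ι_one (hcpt := hcpt)⟩ with hμ₀
  have hnd : ((n * Module.finrank ℚ K : ℕ) : ℂ) ≠ 0 := by
    rw [Nat.cast_ne_zero]
    exact Nat.mul_ne_zero (NeZero.ne n) Module.finrank_pos.ne'
  set s : ℂ := -μ₀ / ((n * Module.finrank ℚ K : ℕ) : ℂ) with hs_def
  have hs : s * (n * Module.finrank ℚ K : ℕ) = -μ₀ := by
    rw [hs_def, div_mul_cancel₀ _ hnd]
  -- the Hecke character `|·|^s` and the twist `c = |det|^s`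
  obtain ⟨χ, hχ⟩ := exists_heckeCharacter_ideleNorm_cpow K s
  set c : (AdelicGroupData.gl n K).Adelic →* ℂˣ := detTwist n χ with hc_def
  -- the differential of `c` along `exp 𝔤`
  obtain ⟨lam, hlam, hfam⟩ := exists_linearMap_detTwist_ofArch_expMem hcpt
  set δ : (AutomorphyDatum.gl n K hcpt).arch.lie →ₗ[ℝ] ℂ := s • (Complex.ofRealCLM.toLinearMap.comp lam) with hδ_def
  have hδ_apply : ∀ X, δ X = s * (lam X : ℂ) := fun X => rfl
  have hcexp : ∀ X : (AutomorphyDatum.gl n K hcpt).arch.lie,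
      (c ((AutomorphyDatum.gl n K hcpt).ofArch ((AutomorphyDatum.gl n K hcpt).arch.expMem X)) : ℂ) =
        Complex.exp (δ X) := fun X => by rw [hδ_apply, hc_def, hfam χ s hχ X]
  have hδbr : ∀ X Y : (AutomorphyDatum.gl n K hcpt).arch.lie, δ ⁅X, Y⁆ = 0 := fun X Y => by
    rw [hδ_apply, hlam X Y, Complex.ofReal_zero, mul_zero]
  -- the Casimir eigenvalue of the twists
  obtain ⟨w, hw⟩ := exists_applyFree_casimirWord_mulChar_eq_smul (AutomorphyDatum.gl n K hcpt).ofArch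
    (SelfDualUnits.mixedSpace K) hcexp hδbr θ
  -- the finite-dimensional target space
  have hfin := finiteDimensional_span_cuspForms_of_casimir_eq_smul (hcpt := hcpt) hU w M hM
  -- the generating set and its image under the twist
  set S : Set ((AdelicGroupData.gl n K).Adelic → ℂ) :=
    {φ : (AdelicGroupData.gl n K).Adelic → ℂ |
      IsCuspFormGL n K hcpt φ ∧ IsRightInvariantUnder U φ ∧
      HasZCharacter (AutomorphyDatum.gl n K hcpt).ofArch φ θ ∧
      ∀ g : (AdelicGroupData.gl n K).Adelic,
        (fun k : Kinf n K => φ (g * (AutomorphyDatum.gl n K hcpt).ofK k)) ∈ M} with hS_def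
  change FiniteDimensional ℂ (Submodule.span ℂ S)
  -- `c = 1` on the level and on `K_∞`
  have hcU : ∀ u ∈ U, (c u : ℂ) = 1 := fun u hu => by
    rw [hc_def, detTwist_apply', apply_det_eq_one_of_mem_finiteLevelsGL hχ hU hu, Units.val_one]
  have hcK : ∀ k : Kinf n K, (c ((AutomorphyDatum.gl n K hcpt).ofK k) : ℂ) = 1 := fun k => by
    have h1 : GaloisRepresentations.ideleNorm (Matrix.GeneralLinearGroup.det (GLn.ofInfinite n K (k : GL (Fin n) (mixedSpace K)))) = 1 := by
      rw [← coe_coe_detNormUnit, detNormUnit_ofInfinite_eq_one_of_mem_Kinf k.2, Units.val_one, NNReal.coe_one]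
    rw [hc_def, detTwist_apply', hχ]
    change (GaloisRepresentations.ideleNorm (Matrix.GeneralLinearGroup.det (GLn.ofInfinite n K (k : GL (Fin n) (mixedSpace K)))) : ℂ) ^ s = 1
    rw [h1, Complex.ofReal_one, Complex.one_cpow]
  -- the twist maps `S` into the spanning set of the target space
  have hmap : ∀ φ ∈ S, mulChar c φ ∈
      {ψ : (AdelicGroupData.gl n K).Adelic → ℂ |
        IsCuspFormGL n K hcpt ψ ∧
        (∀ z ∈ (AdelicGroupData.gl n K).center', ∀ g, ψ (z * g) = ψ g) ∧
        IsRightInvariantUnder U ψ ∧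
        applyFree (AutomorphyDatum.gl n K hcpt).ofArch (casimirWord (N := Fin n) (SelfDualUnits.mixedSpace K)) ψ = w • ψ ∧
        ∀ g : (AdelicGroupData.gl n K).Adelic,
          (fun k : Kinf n K => ψ (g * (AutomorphyDatum.gl n K hcpt).ofK k)) ∈ M} := by
    rintro φ ⟨hφ, hφU, hθφ, hφM⟩
    refine ⟨hφ.mulChar_detTwist_of_cpow hχ, ?_, fun u hu g => ?_, hw φ hφ.1.archSmooth hθφ, fun g => ?_⟩
    · -- `A_G`-invariance after the twist
      intro z hz g
      rw [AdelicGroupData.gl_center'] at hz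
      obtain ⟨t, rfl⟩ := hz
      exact mulChar_detTwist_apply_posRealScalar_mul_of_cpow hχ hs
        (apply_posRealScalar_mul_eq_cpow_of_hasZCharacter hφ.1.archSmooth hθφ) t g
    · -- the level
      have hmul : c (g * u) = c g * c u := map_mul c g u
      rw [mulChar_apply, mulChar_apply, hmul, Units.val_mul, hcU u hu, mul_one, hφU u hu g]
    · -- the slices
      have e : (fun k : Kinf n K => mulChar c φ (g * (AutomorphyDatum.gl n K hcpt).ofK k)) =
          (c g : ℂ) • fun k : Kinf n K => φ (g * (AutomorphyDatum.gl n K hcpt).ofK k) := by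
        funext k
        rw [Pi.smul_apply, smul_eq_mul, mulChar_apply, map_mul, Units.val_mul, hcK k, mul_one]
      rw [e]
      exact M.smul_mem _ (hφM g)
  -- the twist is injective
  have hinj : Function.Injective (mulChar c : ((AdelicGroupData.gl n K).Adelic → ℂ) →ₗ[ℂ] _) := by
    intro φ ψ hφψ
    funext g
    have hg := congrFun hφψ g
    rw [mulChar_apply, mulChar_apply] at hg
    exact mul_left_cancel₀ (Units.ne_zero _) hg
  -- conclude
  have hle : (Submodule.span ℂ S).map (mulChar c) ≤ Submodule.span ℂ
      {ψ : (AdelicGroupData.gl n K).Adelic → ℂ |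
        IsCuspFormGL n K hcpt ψ ∧
        (∀ z ∈ (AdelicGroupData.gl n K).center', ∀ g, ψ (z * g) = ψ g) ∧
        IsRightInvariantUnder U ψ ∧
        applyFree (AutomorphyDatum.gl n K hcpt).ofArch (casimirWord (N := Fin n) (SelfDualUnits.mixedSpace K)) ψ = w • ψ ∧
        ∀ g : (AdelicGroupData.gl n K).Adelic,
          (fun k : Kinf n K => ψ (g * (AutomorphyDatum.gl n K hcpt).ofK k)) ∈ M} := by
    rw [Submodule.map_span, Submodule.span_le]
    rintro _ ⟨φ, hφ, rfl⟩
    exact Submodule.subset_span (hmap φ hφ)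
  haveI : FiniteDimensional ℂ ((Submodule.span ℂ S).map (mulChar c)) := Submodule.finiteDimensional_of_le hle
  exact Module.Finite.equiv (Submodule.equivMapOfInjective _ hinj (Submodule.span ℂ S)).symm

/-- **The same for every `n`** (for `n = 0` the group `GL_0(𝔸_K)` is trivial and every space of
functions on it is finite-dimensional). [cite: BorelJacquet1979, 4.3 (i)] -/
theorem finiteDimensional_span_cuspForms_of_hasZCharacter'
    {U : Subgroup (GL (Fin n) (AdeleRing (𝓞 K) K))} (hU : U ∈ finiteLevelsGL n K)
    (θ : centerU (archGroupGL n K) →ₐ[ℝ] ℂ)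
    (M : Submodule ℂ (Kinf n K → ℂ)) [FiniteDimensional ℂ M]
    (hM : ∀ k₀ : Kinf n K, ∀ f ∈ M, (fun k => f (k * k₀)) ∈ M) :
    FiniteDimensional ℂ (Submodule.span ℂ
      {φ : (AdelicGroupData.gl n K).Adelic → ℂ |
        IsCuspFormGL n K hcpt φ ∧ IsRightInvariantUnder U φ ∧
        HasZCharacter (AutomorphyDatum.gl n K hcpt).ofArch φ θ ∧
        ∀ g : (AdelicGroupData.gl n K).Adelic,
          (fun k : Kinf n K => φ (g * (AutomorphyDatum.gl n K hcpt).ofK k)) ∈ M}) := by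
  rcases Nat.eq_zero_or_pos n with hn | hn
  · subst hn
    haveI : Subsingleton (Matrix (Fin 0) (Fin 0) (AdeleRing (𝓞 K) K)) := inferInstance
    haveI : Finite (AdelicGroupData.gl 0 K).Adelic :=
      (show Finite (GL (Fin 0) (AdeleRing (𝓞 K) K)) from inferInstance)
    infer_instance
  · haveI : NeZero n := ⟨hn.ne'⟩
    exact finiteDimensional_span_cuspForms_of_hasZCharacter hU θ M hM

end Character

end Literature.NumberTheory.Automorphic
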